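import Summits.CriticalPhenomena.PercolationContinuityZ3.Theorems.Transplant.SubgraphLocModCycle
import HarnessLib

/-!
# Routes from cycle data, III: a cycle kit by SURGERY from two disjoint columns and an arbitrary connecting walk

builds on p205010 (kernel theorem, internal audit signed; external expert review pending) — nothing in this file uses p205010.
Lane `prim-bschramm`, seat `prim-bschramm-p4` gen 14 (PART C3 of `P4-GENERAL.md`, §36: Φ2 at the interface level).  Helper file
(`--supports stmt-CriticalPhenomena-4575 --as helper`).  Pure graph theory; sequel of `SubgraphLocModCycle` (gen 10).

The Cayley-graph kits of gen 10/11 (`CayleyCylinderCycle`, `CayleyCylinderCycleBox`) verified the three meeting conditions of a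
`SubLoc.CycleKit` (`A ∩ M = {p}`, `M ∩ B = {q}`, `A ∩ B = ∅`) by exact `φ`-bookkeeping of group words.  At the level of a bare planar
skeleton (no group) the connecting walk `M₀` is only known to stay in an "outside" region, so the kit is obtained by SURGERY instead:
**`SubLoc.exists_cycleKit_of_walks`** — given vertex-disjoint paths `A : x → p`, `B : q → y`, ANY walk `M₀ : p → q` whose vertices
satisfy a predicate `P` ("outside the small cylinder") false at `x` and `y`, and an enhancement class `E'` containing every edge with
both ends in `P`, there is a `CycleKit H E' x y` whose columns are sub-walks of `A`, `B` and whose run is a sub-walk of `M₀.bypass`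
(shorten `M₀` to a path, cut it at its LAST vertex on `A`, then at its FIRST vertex on `B`; trim `A` and `B` accordingly).
[cite: BalisterBollobasRiordan2014, §"bond percolation" p. 13] [cite: AizenmanGrimmett1991, §2 (essential enhancements)]
-/

namespace Summit.CriticalPhenomena.PercolationContinuityZ3.Theorems.Transplant

namespace SubLoc

open SimpleGraph Walk

variable {V : Type} {H : SimpleGraph V}

/-- An edge of a walk has both ends on the walk and is an edge of the graph. [folklore] -/
theorem mem_edges_elim {a b : V} (W : H.Walk a b) {d : Sym2 V} (hd : d ∈ W.edges) :
    ∃ u v, d = s(u, v) ∧ H.Adj u v ∧ u ∈ W.support ∧ v ∈ W.support := by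
  induction d using Sym2.inductionOn with
  | hf u v =>
    exact ⟨u, v, rfl, by simpa using W.edges_subset_edgeSet hd, W.fst_mem_support_of_mem_edges hd,
      W.snd_mem_support_of_mem_edges hd⟩

/-- **CYCLE KIT BY SURGERY.**  Disjoint paths `A : x → p` and `B : q → y`, a walk `M₀ : p → q` inside a vertex predicate `P` with
`¬ P x`, `¬ P y`, every `H`-edge with both ends in `P` an enhancement edge, and the closing edge `y ~ x` give a `CycleKit H E' x y`
whose columns lie on `A`, `B` and whose run lies on `M₀`. [cite: BalisterBollobasRiordan2014, §"bond percolation" p. 13] -/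
theorem exists_cycleKit_of_walks [DecidableEq V] {E' : Set (Sym2 V)} {x y p q : V} (A : H.Walk x p) (B : H.Walk q y) (M₀ : H.Walk p q)
    (hA : A.IsPath) (hB : B.IsPath) (hAB : ∀ w, w ∈ A.support → w ∈ B.support → False)
    (P : V → Prop) (hM₀ : ∀ w ∈ M₀.support, P w) (hx : ¬ P x) (hy : ¬ P y)
    (hE : ∀ ⦃u v : V⦄, H.Adj u v → P u → P v → s(u, v) ∈ E') (hyx : H.Adj y x) :
    ∃ K : CycleKit H E' x y, (∀ w ∈ K.A.support, w ∈ A.support) ∧ (∀ w ∈ K.B.support, w ∈ B.support) ∧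
      (∀ w ∈ K.M.support, w ∈ M₀.support) := by
  -- shorten the run to a path
  set M₁ : H.Walk p q := M₀.bypass with hM₁
  have hM₁P : M₁.IsPath := M₀.bypass_isPath
  have hM₁s : ∀ w ∈ M₁.support, w ∈ M₀.support := fun w hw => M₀.support_bypass_subset_support hw
  -- cut at the LAST vertex on `A` (= first vertex on `A` of the reversed run)
  obtain ⟨a, haA, π, r, hπr, hπ⟩ := exists_first_hit M₁.reverse {w | w ∈ A.support} A.end_mem_support
  have hπP : π.IsPath := by
    have h : (π.append r).IsPath := by rw [hπr]; exact hM₁P.reverse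
    exact h.of_append_left
  have hπs : ∀ w ∈ π.support, w ∈ M₀.support := fun w hw => by
    have h1 : w ∈ (π.append r).support := by rw [Walk.mem_support_append_iff]; exact Or.inl hw
    rw [hπr, Walk.support_reverse, List.mem_reverse] at h1
    exact hM₁s w h1
  set M₂ : H.Walk a q := π.reverse with hM₂
  have hM₂P : M₂.IsPath := hπP.reverse
  have hM₂s : ∀ w ∈ M₂.support, w ∈ π.support := fun w hw => by
    rwa [hM₂, Walk.support_reverse, List.mem_reverse] at hw
  -- cut at the FIRST vertex on `B`
  obtain ⟨b, hbB, π₂, r₂, hπr₂, hπ₂⟩ := exists_first_hit M₂ {w | w ∈ B.support} B.start_mem_support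
  have hπ₂P : π₂.IsPath := by
    have h : (π₂.append r₂).IsPath := by rw [hπr₂]; exact hM₂P
    exact h.of_append_left
  have hπ₂s : ∀ w ∈ π₂.support, w ∈ M₂.support := fun w hw => by
    rw [← hπr₂, Walk.mem_support_append_iff]; exact Or.inl hw
  have haP : P a := hM₀ a (hπs a π.end_mem_support)
  have hbP : P b := hM₀ b (hπs b (hM₂s b (hπ₂s b π₂.end_mem_support)))
  refine ⟨⟨a, b, A.takeUntil a haA, π₂, B.dropUntil b hbB, hA.takeUntil haA, hπ₂P, hB.dropUntil hbB, ?_, ?_, ?_, ?_, ?_, ?_, ?_, hyx⟩,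
    fun w hw => A.support_takeUntil_subset_support haA hw, fun w hw => B.support_dropUntil_subset_support hbB hw,
    fun w hw => hπs w (hM₂s w (hπ₂s w hw))⟩
  · exact fun h => hAB a haA (h ▸ hbB)
  · exact fun h => hx (h ▸ haP)
  · exact fun h => hy (h ▸ hbP)
  · intro w hwA hwM
    exact hπ w (hM₂s w (hπ₂s w hwM)) (A.support_takeUntil_subset_support haA hwA)
  · intro w hwM hwB
    exact hπ₂ w hwM (B.support_dropUntil_subset_support hbB hwB)
  · intro w hwA hwB
    exact hAB w (A.support_takeUntil_subset_support haA hwA) (B.support_dropUntil_subset_support hbB hwB)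
  · intro d hd
    obtain ⟨u, v, rfl, huv, hu, hv⟩ := mem_edges_elim π₂ hd
    exact hE huv (hM₀ u (hπs u (hM₂s u (hπ₂s u hu)))) (hM₀ v (hπs v (hM₂s v (hπ₂s v hv))))

/-- The zone of a kit obtained by surgery lies on the three given walks. [folklore] -/
theorem CycleKit.Z_subset_of_supports {E' : Set (Sym2 V)} {x y p q : V} {A : H.Walk x p} {B : H.Walk q y} {M₀ : H.Walk p q}
    (K : CycleKit H E' x y) (h₁ : ∀ w ∈ K.A.support, w ∈ A.support) (h₂ : ∀ w ∈ K.B.support, w ∈ B.support)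
    (h₃ : ∀ w ∈ K.M.support, w ∈ M₀.support) :
    K.Z ⊆ {w | w ∈ A.support ∨ w ∈ M₀.support ∨ w ∈ B.support} := by
  rintro w (hw | hw | hw)
  · exact Or.inl (h₁ w hw)
  · exact Or.inr (Or.inl (h₃ w hw))
  · exact Or.inr (Or.inr (h₂ w hw))

end SubLoc

end Summit.CriticalPhenomena.PercolationContinuityZ3.Theorems.Transplant
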